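import Mathlib
import Summits.Ventures.HodgeRepro2.T6NAut3
import Summits.Ventures.HodgeRepro2.T6N2ToyJoint

/-!
# T6N2ToyJoint3 — the seven binders of `periodInputN_of_mains₃` hold jointly on a v3 carrier with
NO hypothesis (README §10.5(ii)(d) at the mains level for the RE-CUT carrier; owner t6-p5)

T6N2ToyJoint (p405772) exhibits, for every face setting `F`, a period datum and a v2 carrier on
which the seven binders of the lead's v2 composition `periodInputN_of_mains₂` hold at once with
nothing assumed (`N2ToyJoint.exists_joint₂`). The lead's re-cut v3 carrier `NAut3` (T6NAut3,
p406934) has the same owner-level sentences — `pairing`, `AdmDatum`, `AdmData`, `iA` … `N5` are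
the same fields — and `NAut3.ofNAut2` maps a v2 carrier to a v3 one keeping every one of them
(`rfl`). So the v2 witness IS a v3 witness: `toy₃ F hw hw0` (the lead's v2 toy carrier with the
explicit-isometry datum, mapped to v3), `exists_joint₃ F` — the seven binders of
`periodInputN_of_mains₃` joint with no hypothesis — and `toy_periodInputN_of_mains₃` — the v3
composition fires on the lead's toy period datum `toyNDatumN F hw hw0`. This is the
joint-consistency report of the v3 LOGIC (the mains-level binders) — in the lead's classification a
COMPOSITION CHECK of the mains logic (t6-lead STATUS l. 11364 (3); M10-4-FILELISTS «Correction
2026-08-25» class), NOT the §10.5(ii)(d) witness of the M2 v6 DISPLAY set over `NAut3`: that witness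
is the joint toy v2 of the lead's plan of record (l. 11316 (4) / l. 11351 (2): t6-p1's non-degenerate
N1 shadow, t6-p3's N3 instance, t6-p6's assembly), to which this file contributes N2's binder only.

README §8(d): uses an L-value-free non-vanishing device: NO (TIER5 §N2, a pre-02:16Z line of
record — N2 asserts no non-vanishing — continued).
-/

namespace Summit.Ventures.HodgeRepro2.T6.N2ToyJoint3

open scoped InnerProductSpace
open NAutToyN

variable {K : Type} [Field K] [NumberField K] [NumberField.IsCMField K]

/-- THE v3 TOY CARRIER: the lead's v2 toy `NAut2Toy.toy` with the explicit-isometry N2 datum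
`N2ToyJoint.d2`, mapped to the re-cut carrier by `NAut3.ofNAut2`. -/
noncomputable def toy₃ (F : FaceSetting K) {σ : K →+* ℂ} {w : KC K} (hw : w ∈ eigenLineK K σ)
    (hw0 : w ≠ 0) : NAut3 F (toyNDatumN F hw hw0) :=
  NAut3.ofNAut2 (NAut2Toy.toy F hw hw0 (N2ToyJoint.d2 F (toyNDatumN F hw hw0)))

/-- N2's binder on the v3 toy carrier, with no hypothesis. -/
theorem toy₃_admDatum (F : FaceSetting K) {σ : K →+* ℂ} {w : KC K} (hw : w ∈ eigenLineK K σ)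
    (hw0 : w ≠ 0) : (toy₃ F hw hw0).AdmDatum :=
  (N2Datum.reindex_adm _ _).2 (N2ToyJoint.d2_adm F _)

/-- Every quadruple of Schwartz data is admissible on the v3 toy carrier. -/
theorem toy₃_admData (F : FaceSetting K) {σ : K →+* ℂ} {w : KC K} (hw : w ∈ eigenLineK K σ)
    (hw0 : w ≠ 0) (φ : N3Toy.toy.A.Sa × N3Toy.toy.A.Sb × N3Toy.toy.B.Sa × N3Toy.toy.B.Sb) :
    (toy₃ F hw hw0).AdmData φ :=
  (N2Datum.reindex_admData _ _ _).2 (N2ToyJoint.d2_admData F _ φ)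

/-- JOINT CONSISTENCY OF THE v3 COMPOSITION'S HYPOTHESES WITH NO HYPOTHESIS: for every face setting
`F` some period datum and some v3 carrier satisfy the seven binders of `periodInputN_of_mains₃`
jointly — the v2 witness of `N2ToyJoint.exists_joint₂` mapped by `NAut3.ofNAut2`. -/
theorem exists_joint₃ (F : FaceSetting K) :
    ∃ (P : NDatum F) (M : NAut3 F P),
      (∀ c, P.AdmChoice c → M.pairing c ≠ 0 → P.I P.τ₁ c ≠ 0) ∧ M.AdmDatum ∧
      (M.iA → M.iiA → M.ellA) ∧ (M.iB → M.iiB → M.ellB) ∧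
      (M.ellA → M.ellB → ∃ (φa : M.d3.A.Sa) (φb : M.d3.A.Sb) (φc : M.d3.B.Sa) (φd : M.d3.B.Sb),
        M.AdmData (φa, φb, φc, φd) ∧ ⟪M.d3.B.F φc φd, M.d3.A.F φa φb⟫_ℂ ≠ 0) ∧
      (M.iA ∧ M.iB) ∧ M.N5 := by
  obtain ⟨P, M, h1, h2, h3A, h3B, h3iso, h4, h5⟩ := N2ToyJoint.exists_joint₂ F
  exact ⟨P, NAut3.ofNAut2 M, h1, h2, h3A, h3B, h3iso, h4, h5⟩

/-- The v3 composition fires on the lead's toy period datum with the v3 toy carrier: every binder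
of `periodInputN_of_mains₃` instantiated, nothing assumed. -/
theorem toy_periodInputN_of_mains₃ (F : FaceSetting K) {σ : K →+* ℂ} {w : KC K}
    (hw : w ∈ eigenLineK K σ) (hw0 : w ≠ 0) :
    ∃ c, (toyNDatumN F hw hw0).AdmChoice c ∧ Hyp.PeriodN ((toyNDatumN F hw hw0).shadow c) := by
  refine periodInputN_of_mains₃ (toyNDatumN F hw hw0) (toy₃ F hw hw0)
    (fun c _ _ => I_ne_zero F hw hw0 c) (toy₃_admDatum F hw hw0)
    (fun _ _ => N3Toy.toy_N3A) (fun _ _ => N3Toy.toy_N3A) ?_ ⟨N3Toy.toy_hypI, N3Toy.toy_hypI⟩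
    N5Toy.toyData_N5
  intro _ _
  obtain ⟨c, -, hne⟩ :=
    (NAutToyN.toy F hw hw0).exists_choice_of_pairing_ne_zero N3Toy.toy_N3iso
  exact ⟨((NAutToyN.toy F hw hw0).data c).1, ((NAutToyN.toy F hw hw0).data c).2.1,
    ((NAutToyN.toy F hw hw0).data c).2.2.1, ((NAutToyN.toy F hw hw0).data c).2.2.2,
    toy₃_admData F hw hw0 _, hne⟩

end Summit.Ventures.HodgeRepro2.T6.N2ToyJoint3
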